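import Summits.QuantumFields.BalabanUV.Beta.MultiscaleCombesThomasBudget
import Literature.MathematicalPhysics.QuantumFieldTheory.Balaban1983to89.B9Ineq347

/-!
# `Summit.QuantumFields.BalabanUV.Beta.MultiscaleCombesThomasL2` — the ℓ²-LOCALIZED OPERATOR form of the site-local
# Combes–Thomas engine: from the SITEWISE conjugated-coercivity profile, the bound
# `‖1_S·A⁻¹v‖ ≤ e^{−κ(R − ω)}·‖v‖/√(ν_S ν_{S′})` for data `v` supported in a set `S′` and any target set `S`
# (file 5 of the engine; the SHAPE of the L²-norm member (3.46)₁ of [B9] Thm 3.1; its one-prefactor form; file 6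
# `MultiscaleCombesThomasL2Real` = the same in the REAL-operator currency of the MODEL instance)

HONEST FRAMING (page 1 of everything in this cell).  Discharging `FlowStep.BetaPertH` would make Bałaban's ultraviolet
stability UNCONDITIONAL — a constructive-QFT result; it is NOT the continuum limit and NOT the Clay problem.  This module
discharges nothing of `BetaPertH`; it is ELEMENTARY finite-dimensional linear algebra ([folklore]: the Agmon ∕ Combes–Thomas
weighted-ℓ² bookkeeping), kernel-checked, written by the OWNER of binder row D4 (unit `b2b-balaban-beta-an4`, gen 43; claim
«MULTISCALE-CT-L2LOCAL», journal l.19274) for NODE O.2 item (v) «k-UNIFORM constants» of the owner's outline.  HONEST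
DEPENDENCY: continuum YM on T⁴ ⇐ BetaPertH ∧ nine spine estimates (0/9 proved); BetaPertH ⇐ (D1) ∧ (D4) ∧ CAP+tail; G-an2-4
gates asym, D1 and NE2/3/4.

WHY THIS FILE (currency precision E-an4-136 → E-an4-139).  Files 1–4 of the engine (`MultiscaleCombesThomas`, `…Budget`,
`…Covariant`, `…Averaging`, gen 42) and the MODEL instance of co-owner beta-d4-p2 (`MultiscaleDecay.decay_levelOp`, p230877:
`|(levelOp)⁻¹((x,i),(y,i′))| ≤ e^{−κd_n(x,y)}·n(x)n(y)/μ₀`) are ENTRY ∕ ℓ²-PAIRING statements.  The cross-read C-d4p3-28 of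
beta-d4-p3 fixed the wording: print's (3.42) ([Balaban1985BackgroundPropagators] Thm 3.1 p. 397) is a SUP-norm operator
bound and needs a local ℓ² → ℓ^∞ device the tree does not have (O.2 item (ii)).  But Thm 3.1 ALSO has an L²-NORM member,
p. 398, verbatim (render `…1985-cmp99-background-propagators-p010-x2.png`, read as image by this seat):

> *"Finally, we have the inequalities in L²-norms ‖hG′(U)λ‖, ‖h∇_UG′(U)λ‖, ‖hG′(U)∇*_Uλ‖, ‖h∇_U∇_UG′(U)λ‖, ‖h∇_UG′(U)∇*_Uλ‖,
> ‖hG′(U)∇*_U∇*_Uλ‖ ≦ B₀[(L^jη)², L^jη, L^jη, 1, 1, 1]|h|e^{−δ₀d(y,y′)}‖λ‖ for supp h ⊂ Δ(y), y ∈ Λ_j, supp λ ⊂ Δ(y′); (3.46)"*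

and the remark after (3.47), p. 398, verbatim: *"the choice of powers L^jη is conventional also. Using Lemma 2.1 in [4] we may
replace the factor (L^jη)^α by (L^jη)^β(L^{j′}η)^γ with β + γ = α, j, j′ are indices of localizations."*  The FIRST member
of (3.46) is exactly the native currency of the site-local engine: a localized ℓ² → ℓ² bound with a local prefactor.  This
file states that form abstractly (§1–§2), its one-prefactor version under a scale-transfer hypothesis of the (2.60)-kind
(§3); the sibling file 6 `MultiscaleCombesThomasL2Real` restates §1 in the REAL-operator currency in which the MODEL
instance is written, so that `decay_levelOp`'s hypothesis lemma `MultiscaleDecay.hc_levelOp` feeds it verbatim.  What this says for the row: the engine + the MODEL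
instance reach the SHAPE of (3.46)₁ with NO ℓ² → ℓ^∞ step; the sup-norm members (3.42)–(3.45) stay behind item (ii).
Print's own route to ALL of (3.42)–(3.47) is the random-walk representation (p. 398: *"We will prove the above theorem by
constructing a random walk representation similar to that in (2.40)"*), NOT a Combes–Thomas argument — ours is an
independent kernel route to the L² member's SHAPE, at the abstract ∕ MODEL level only.

CONTENT (all [folklore]; `X` a finite index type; currency of `AccretiveCombesThomas`: `conjForm A κ ρ z =
Σ_{e,e′} z̄_e e^{κ(ρ_e − ρ_{e′})} A(e,e′) z_{e′}`, `nsq z = Σ_e ‖z_e‖²`; hypothesis SHAPES written out, no `Prop`-valued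
definitions, no new `def` at all).
* §1 SETS AND ONE WEIGHT.  From `∀ z, Σ_x μ_x‖z_x‖² ≤ Re conjForm A κ ρ z` (ONE weight `ρ`, sitewise profile `μ > 0`) and
  `Aw = v` with `v` supported in a finite set `S′` on which `ρ ≤ ω` and `μ ≥ ν′`, for ANY set `S` on which `R ≤ ρ` and `μ ≥ ν`:
  `ν·e^{2κR}·Σ_{x∈S}‖w_x‖² ≤ ν′⁻¹·e^{2κω}·Σ_{x∈S′}‖v_x‖²` (`weighted_set_solution_bound`, from file 1's
  `local_solution_bound` BY NAME), hence **`set_norm_inv_le`**: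
  `√(Σ_{x∈S}‖(A⁻¹v)_x‖²) ≤ e^{−κ(R−ω)}/√(νν′) · √(Σ_{x∈S′}‖v_x‖²)` — (3.46)₁'s SHAPE with the geometric-mean prefactor;
  the MULTIPLIER form `√(nsq (h ⊙ A⁻¹v)) ≤ H·e^{−κ(R−ω)}/√(νν′)·√(Σ_{S′}‖v‖²)` for `supp h ⊆ S`, `‖h‖ ≤ H`
  (`mul_norm_inv_le` — literally «‖hG′λ‖ ≤ … |h| e^{−δ₀d} ‖λ‖»); and the PAIRING form `|u^*A⁻¹v| ≤ …·√(nsq u)·√(Σ_{S′}‖v‖²)`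
  for `supp u ⊆ S` (`pairing_inv_le`).  With the site weight `ρ = κ·d_n(·, j)`, `j ∈ Δ(y′)`, `S = Δ(y)`, `S′ = Δ(y′)`:
  `ω` = the oscillation of `d_n(·, j)` over the source cell (≤ 2d, co-owner's `MultiscaleDistance` §3), `R ≥ d_n(y,y′) − O(1)`,
  `ν = μ₀/n(y)²`, `ν′ = μ₀/n(y′)²` ⟹ `‖1_{Δ(y)}G1_{Δ(y′)}‖ ≤ e^{O(κ)}·n(y)n(y′)/μ₀ · e^{−κd_n(y,y′)}` — level-count- and
  volume-free.  (REMARK recorded for the junction with block-constant weights `x ↦ D(blk x, y′)` (the hypothesis currency of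
  `AccretiveCombesThomasSandwichLocal`): for the multi-region operator that hypothesis is NOT available with a level-free rate —
  a weight jumping by `κ` across a face of a TOP cell (side `n_max`) is tested by a slab function of width `ℓ` across the face,
  for which the conjugation defect is `≍ c²κ²` per unit face area against an energy `≍ c²/ℓ + aℓ/n_max²`, forcing
  `κ² ≲ √a/(c·n_max) → 0` as the number of levels grows; the level-free route is the SITE weight of this file (Lipschitz
  on the local scale) plus the intra-cell oscillation `ω`, as above.)
* §2 `inv_mulVec_eq` housekeeping (`A(A⁻¹v) = v` from the local hypothesis at any one weight).
* §3 ONE PREFACTOR.  `prefactor_transfer`: `e^{−κT}/√(νν′) ≤ C·e^{−(1−α)κT}/ν` whenever `e^{−ακT}·√(ν/ν′) ≤ C` (pure algebra),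
  and `scaleTransfer_of_levels`: that hypothesis with `C = Λ` from `(2.60)`-shaped data `e^{−ακT} ≤ q^{m−1}`, `√(ν/ν′) ≤ Λ^m`,
  `Λq ≤ 1` (b09's `B9Ineq347.pow_pred_mul_pow_le` BY NAME — the abstract content of «we may replace the factor (L^jη)^α by
  (L^jη)^β(L^{j′}η)^γ»); `set_norm_inv_le_onePrefactor` = §1 ∘ §3: the TARGET-prefactor form `C·e^{−(1−α)κ(R−ω)}/ν` =
  print's `(L^jη)²`-at-the-target shape.  `sqrt_ratio_of_sq_profile`: for `ν = μ₀/s²`, `ν′ = μ₀/s′²` the ratio is `s′/s`.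
* §4 WITNESS: the hypothesis list of `set_norm_inv_le` is jointly satisfiable and the bound fires (one site).
* THE REAL-OPERATOR CURRENCY (the MODEL's: `A : Module.End ℝ (X → ℝ)` with the conjugated-PAIRING hypothesis of
  `MultiscaleDecay.hc_levelOp` ∕ file 2's `norm_cmat_inv_apply_le_local`, END for `Ring.inverse A`) is file 6,
  `MultiscaleCombesThomasL2Real` (size rule).

ABSOLUTE RULE.  Nothing printed is cited as a fact; no manuscript statement enters as a hypothesis; (3.46) ∕ the p. 398 remark
of [Balaban1985BackgroundPropagators] and (2.60) of [Balaban1984PropagatorsII] are LOCATORS of shapes only.  Nothing of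
Bałaban's operators is instantiated; weights, metrics, cells are instance data.  Declarations of the lineage's
`MultiscaleCombesThomas` ∕ `…Budget` ∕ `AccretiveCombesThomas`, of b05's `B5Prop11Lower` and b09's `B9Ineq347` are used BY
NAME, never restated.  Row D4: an abstract engine file for O.2 item (v)'s decay half in the ℓ²-operator currency; class of
(T3) ∕ NODE O.2 UNCHANGED (critical-path width 0); D4 DISCHARGE NO DATE; NOT BetaPertH, NOT continuum, NOT Clay, NOT summit
progress.  References (method only): J.-M. Combes, L. Thomas, Commun. Math. Phys. 34 (1973) 251–270; S. Agmon, *Lectures on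
exponential decay of solutions of second-order elliptic equations*, Princeton 1982.
-/

open scoped BigOperators Matrix ComplexConjugate
open Finset Complex Matrix

namespace Summit.QuantumFields.BalabanUV.Beta.MultiscaleCombesThomasL2

open Summit.QuantumFields.BalabanUV.Beta.AccretiveCombesThomas
open Summit.QuantumFields.BalabanUV.Beta.MultiscaleCombesThomas (local_solution_bound isUnit_of_localConjCoercive)
open Literature.MathematicalPhysics.QuantumFieldTheory.Balaban1983to89.B5Prop11Lower (nsq nsq_nonneg
  norm_star_dotProduct_le)
open Summit.QuantumFields.BalabanUV.T4Continuum.RegionGaugeSliceOrth (le_of_le_sqrt_mul_sqrt)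
open Literature.MathematicalPhysics.QuantumFieldTheory.Balaban1983to89.B9Ineq347 (pow_pred_mul_pow_le)

noncomputable section

variable {X : Type*} [Fintype X]

/-! ## §1 Sets and one weight: the localized weighted solution bound and the (3.46)₁ shape -/

/-- The norm of a weighted entry: `‖(e^{t} : ℂ)·c‖² = e^{2t}·‖c‖²`. [folklore] -/
theorem norm_sq_exp_mul (t : ℝ) (c : ℂ) :
    ‖((Real.exp t : ℝ) : ℂ) * c‖ ^ 2 = Real.exp (2 * t) * ‖c‖ ^ 2 := by
  rw [norm_mul, Complex.norm_real, Real.norm_eq_abs, abs_of_pos (Real.exp_pos t), mul_pow,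
    show (2 : ℝ) * t = t + t by ring, Real.exp_add, sq]

/-- **The localized weighted solution bound (sets, one weight).**  `A` locally conjugated-coercive with the sitewise
profile `μ > 0` at `(κ, ρ)`; `Aw = v` with `v` supported in the finite set `S′`, on which `ρ ≤ ω` and `ν′ ≤ μ`; `S` any
set on which `R ≤ ρ` and `ν ≤ μ` (`ν′ > 0`, `κ ≥ 0`).  Then
`ν·e^{2κR}·Σ_{x∈S}‖w_x‖² ≤ ν′⁻¹·e^{2κω}·Σ_{x∈S′}‖v_x‖²` — file 1's `local_solution_bound` read on the two sets. [folklore] -/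
theorem weighted_set_solution_bound {A : Matrix X X ℂ} {κ : ℝ} {ρ : X → ℝ} {μ : X → ℝ} (hμ : ∀ x, 0 < μ x)
    (hκ : 0 ≤ κ) (hc : ∀ z : X → ℂ, ∑ x, μ x * ‖z x‖ ^ 2 ≤ (conjForm A κ ρ z).re) {w v : X → ℂ}
    (hw : A *ᵥ w = v) (S S' : Finset X) (hv : ∀ x, x ∉ S' → v x = 0) {R ω ν ν' : ℝ} (hν' : 0 < ν')
    (hR : ∀ x ∈ S, R ≤ ρ x) (hω : ∀ x ∈ S', ρ x ≤ ω) (hνS : ∀ x ∈ S, ν ≤ μ x) (hνS' : ∀ x ∈ S', ν' ≤ μ x) :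
    ν * Real.exp (2 * (κ * R)) * ∑ x ∈ S, ‖w x‖ ^ 2 ≤
      (ν')⁻¹ * Real.exp (2 * (κ * ω)) * ∑ x ∈ S', ‖v x‖ ^ 2 := by
  have h := local_solution_bound hμ hc hw
  -- lower bound of the left side of `h` by its `S`-part
  have hL : ν * Real.exp (2 * (κ * R)) * ∑ x ∈ S, ‖w x‖ ^ 2 ≤
      ∑ x, μ x * ‖((Real.exp (κ * ρ x) : ℝ) : ℂ) * w x‖ ^ 2 := by
    calc ν * Real.exp (2 * (κ * R)) * ∑ x ∈ S, ‖w x‖ ^ 2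
        = ∑ x ∈ S, ν * Real.exp (2 * (κ * R)) * ‖w x‖ ^ 2 := by rw [Finset.mul_sum]
      _ ≤ ∑ x ∈ S, μ x * ‖((Real.exp (κ * ρ x) : ℝ) : ℂ) * w x‖ ^ 2 := by
          refine Finset.sum_le_sum fun x hx => ?_
          have hfac : ν * Real.exp (2 * (κ * R)) ≤ μ x * Real.exp (2 * (κ * ρ x)) :=
            mul_le_mul (hνS x hx) (Real.exp_le_exp.mpr (by nlinarith [hR x hx])) (Real.exp_pos _).le (hμ x).le
          calc ν * Real.exp (2 * (κ * R)) * ‖w x‖ ^ 2 ≤ μ x * Real.exp (2 * (κ * ρ x)) * ‖w x‖ ^ 2 :=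
                mul_le_mul_of_nonneg_right hfac (sq_nonneg _)
            _ = μ x * ‖((Real.exp (κ * ρ x) : ℝ) : ℂ) * w x‖ ^ 2 := by rw [norm_sq_exp_mul, mul_assoc]
      _ ≤ ∑ x, μ x * ‖((Real.exp (κ * ρ x) : ℝ) : ℂ) * w x‖ ^ 2 :=
          Finset.sum_le_sum_of_subset_of_nonneg (Finset.subset_univ S) fun x _ _ =>
            mul_nonneg (hμ x).le (sq_nonneg _)
  -- upper bound of the right side of `h` by its `S′`-part
  have hU : ∑ x, (μ x)⁻¹ * ‖((Real.exp (κ * ρ x) : ℝ) : ℂ) * v x‖ ^ 2 ≤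
      (ν')⁻¹ * Real.exp (2 * (κ * ω)) * ∑ x ∈ S', ‖v x‖ ^ 2 := by
    have hsplit : ∑ x, (μ x)⁻¹ * ‖((Real.exp (κ * ρ x) : ℝ) : ℂ) * v x‖ ^ 2 =
        ∑ x ∈ S', (μ x)⁻¹ * ‖((Real.exp (κ * ρ x) : ℝ) : ℂ) * v x‖ ^ 2 := by
      symm
      refine Finset.sum_subset (Finset.subset_univ S') fun x _ hx => ?_
      rw [hv x hx]; simp
    rw [hsplit, Finset.mul_sum]
    refine Finset.sum_le_sum fun x hx => ?_
    have hfac : (μ x)⁻¹ * Real.exp (2 * (κ * ρ x)) ≤ (ν')⁻¹ * Real.exp (2 * (κ * ω)) :=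
      mul_le_mul (inv_anti₀ hν' (hνS' x hx)) (Real.exp_le_exp.mpr (by nlinarith [hω x hx]))
        (Real.exp_pos _).le (inv_nonneg.mpr hν'.le)
    calc (μ x)⁻¹ * ‖((Real.exp (κ * ρ x) : ℝ) : ℂ) * v x‖ ^ 2 = (μ x)⁻¹ * Real.exp (2 * (κ * ρ x)) * ‖v x‖ ^ 2 := by
          rw [norm_sq_exp_mul, mul_assoc]
      _ ≤ (ν')⁻¹ * Real.exp (2 * (κ * ω)) * ‖v x‖ ^ 2 := mul_le_mul_of_nonneg_right hfac (sq_nonneg _)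
  exact hL.trans (h.trans hU)

/-! ## §2 Housekeeping: the inverse solves the equation -/

/-- Under the local hypothesis (any one weight, profile `μ > 0`) `A` is a unit and `A(A⁻¹v) = v`. [folklore] -/
theorem inv_mulVec_eq [DecidableEq X] {A : Matrix X X ℂ} {κ : ℝ} {ρ : X → ℝ} {μ : X → ℝ} (hμ : ∀ x, 0 < μ x)
    (hc : ∀ z : X → ℂ, ∑ x, μ x * ‖z x‖ ^ 2 ≤ (conjForm A κ ρ z).re) (v : X → ℂ) :
    A *ᵥ (A⁻¹ *ᵥ v) = v := by
  have hAu : IsUnit A := isUnit_of_localConjCoercive hμ hc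
  have hdet : IsUnit A.det := (Matrix.isUnit_iff_isUnit_det A).mp hAu
  rw [Matrix.mulVec_mulVec, Matrix.mul_nonsing_inv A hdet, Matrix.one_mulVec]

/-- Square-root bookkeeping: from `ν e^{2κR} P ≤ ν′⁻¹ e^{2κω} Q` (`ν, ν′ > 0`) to
`√P ≤ e^{−κ(R−ω)}/√(νν′)·√Q`. [folklore] -/
theorem sqrt_le_of_weighted {ν ν' κ R ω P Q : ℝ} (hν : 0 < ν) (hν' : 0 < ν')
    (h : ν * Real.exp (2 * (κ * R)) * P ≤ (ν')⁻¹ * Real.exp (2 * (κ * ω)) * Q) :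
    Real.sqrt P ≤ Real.exp (-(κ * (R - ω))) / Real.sqrt (ν * ν') * Real.sqrt Q := by
  have hE : 0 < ν * Real.exp (2 * (κ * R)) := mul_pos hν (Real.exp_pos _)
  have hP' : P ≤ (Real.exp (-(κ * (R - ω))) / Real.sqrt (ν * ν')) ^ 2 * Q := by
    have hfac : (Real.exp (-(κ * (R - ω))) / Real.sqrt (ν * ν')) ^ 2 =
        (ν * Real.exp (2 * (κ * R)))⁻¹ * ((ν')⁻¹ * Real.exp (2 * (κ * ω))) := by
      rw [div_pow, Real.sq_sqrt (mul_pos hν hν').le, sq, ← Real.exp_add]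
      rw [show -(κ * (R - ω)) + -(κ * (R - ω)) = 2 * (κ * ω) - 2 * (κ * R) by ring, Real.exp_sub]
      field_simp
    rw [hfac, mul_assoc]
    calc P ≤ (ν')⁻¹ * Real.exp (2 * (κ * ω)) * Q / (ν * Real.exp (2 * (κ * R))) := (le_div_iff₀' hE).mpr h
      _ = (ν * Real.exp (2 * (κ * R)))⁻¹ * ((ν')⁻¹ * Real.exp (2 * (κ * ω)) * Q) := by rw [div_eq_inv_mul]
  calc Real.sqrt P ≤ Real.sqrt ((Real.exp (-(κ * (R - ω))) / Real.sqrt (ν * ν')) ^ 2 * Q) := Real.sqrt_le_sqrt hP'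
    _ = Real.exp (-(κ * (R - ω))) / Real.sqrt (ν * ν') * Real.sqrt Q := by
        rw [Real.sqrt_mul (sq_nonneg _), Real.sqrt_sq (div_nonneg (Real.exp_pos _).le (Real.sqrt_nonneg _))]

/-- **The ℓ²-LOCALIZED OPERATOR BOUND — the SHAPE of (3.46)₁ with the geometric-mean prefactor.**  `A` locally
conjugated-coercive with the sitewise profile `μ > 0` at `(κ, ρ)`, `κ ≥ 0`; `v` supported in `S′` where `ρ ≤ ω`, `μ ≥ ν′`;
`S` a set where `ρ ≥ R`, `μ ≥ ν`.  Then `√(Σ_{x∈S}‖(A⁻¹v)_x‖²) ≤ e^{−κ(R−ω)}/√(νν′) · √(Σ_{x∈S′}‖v_x‖²)`, i.e.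
`‖1_S A⁻¹ 1_{S′}‖_{ℓ²→ℓ²} ≤ e^{−κ(R−ω)}/√(νν′)`.  For the multi-region operator (`ν = μ₀/n(y)²` on the cell `Δ(y) = S`,
`ν′ = μ₀/n(y′)²` on `Δ(y′) = S′`, `ρ = d_n(·, j)`, `j ∈ Δ(y′)`) this is «‖hG′λ‖ ≤ B₀(·)e^{−δ₀d(y,y′)}‖λ‖» with the prefactor
`n(y)n(y′)/μ₀` — print's `(L^jη)²` after §3's transfer. [cite: Balaban1985BackgroundPropagators, Thm 3.1 (3.46) p.398] [folklore] -/
theorem set_norm_inv_le [DecidableEq X] {A : Matrix X X ℂ} {κ : ℝ} {ρ : X → ℝ} {μ : X → ℝ} (hμ : ∀ x, 0 < μ x)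
    (hκ : 0 ≤ κ) (hc : ∀ z : X → ℂ, ∑ x, μ x * ‖z x‖ ^ 2 ≤ (conjForm A κ ρ z).re) (S S' : Finset X)
    {v : X → ℂ} (hv : ∀ x, x ∉ S' → v x = 0) {R ω ν ν' : ℝ} (hν : 0 < ν) (hν' : 0 < ν')
    (hR : ∀ x ∈ S, R ≤ ρ x) (hω : ∀ x ∈ S', ρ x ≤ ω) (hνS : ∀ x ∈ S, ν ≤ μ x) (hνS' : ∀ x ∈ S', ν' ≤ μ x) :
    Real.sqrt (∑ x ∈ S, ‖(A⁻¹ *ᵥ v) x‖ ^ 2) ≤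
      Real.exp (-(κ * (R - ω))) / Real.sqrt (ν * ν') * Real.sqrt (∑ x ∈ S', ‖v x‖ ^ 2) :=
  sqrt_le_of_weighted hν hν'
    (weighted_set_solution_bound hμ hκ hc (inv_mulVec_eq hμ hc v) S S' hv hν' hR hω hνS hνS')

/-- **The MULTIPLIER form — literally the first member of (3.46).**  With `h` supported in `S` and `‖h_x‖ ≤ H` (`H ≥ 0`):
`√(nsq (h ⊙ A⁻¹v)) ≤ H · e^{−κ(R−ω)}/√(νν′) · √(Σ_{x∈S′}‖v_x‖²)` («‖hG′(U)λ‖ ≤ B₀(·)|h|e^{−δ₀d(y,y′)}‖λ‖ for supp h ⊂ Δ(y),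
supp λ ⊂ Δ(y′)» — SHAPE only). [cite: Balaban1985BackgroundPropagators, Thm 3.1 (3.46) p.398] [folklore] -/
theorem mul_norm_inv_le [DecidableEq X] {A : Matrix X X ℂ} {κ : ℝ} {ρ : X → ℝ} {μ : X → ℝ} (hμ : ∀ x, 0 < μ x)
    (hκ : 0 ≤ κ) (hc : ∀ z : X → ℂ, ∑ x, μ x * ‖z x‖ ^ 2 ≤ (conjForm A κ ρ z).re) (S S' : Finset X)
    {v h : X → ℂ} (hv : ∀ x, x ∉ S' → v x = 0) (hh : ∀ x, x ∉ S → h x = 0) {H : ℝ} (hH0 : 0 ≤ H)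
    (hH : ∀ x, ‖h x‖ ≤ H) {R ω ν ν' : ℝ} (hν : 0 < ν) (hν' : 0 < ν')
    (hR : ∀ x ∈ S, R ≤ ρ x) (hω : ∀ x ∈ S', ρ x ≤ ω) (hνS : ∀ x ∈ S, ν ≤ μ x) (hνS' : ∀ x ∈ S', ν' ≤ μ x) :
    Real.sqrt (nsq (fun x => h x * (A⁻¹ *ᵥ v) x)) ≤
      H * (Real.exp (-(κ * (R - ω))) / Real.sqrt (ν * ν')) * Real.sqrt (∑ x ∈ S', ‖v x‖ ^ 2) := by
  set w : X → ℂ := A⁻¹ *ᵥ v with hwdef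
  have hset := set_norm_inv_le hμ hκ hc S S' hv hν hν' hR hω hνS hνS'
  -- `nsq (h ⊙ w) ≤ H²·Σ_{S}‖w‖²`
  have hle : nsq (fun x => h x * w x) ≤ H ^ 2 * ∑ x ∈ S, ‖w x‖ ^ 2 := by
    have hsplit : nsq (fun x => h x * w x) = ∑ x ∈ S, ‖h x * w x‖ ^ 2 := by
      unfold nsq
      symm
      refine Finset.sum_subset (Finset.subset_univ S) fun x _ hx => ?_
      rw [hh x hx]; simp
    rw [hsplit, Finset.mul_sum]
    refine Finset.sum_le_sum fun x _ => ?_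
    rw [norm_mul, mul_pow]
    exact mul_le_mul_of_nonneg_right (pow_le_pow_left₀ (norm_nonneg _) (hH x) 2) (sq_nonneg _)
  calc Real.sqrt (nsq (fun x => h x * w x)) ≤ Real.sqrt (H ^ 2 * ∑ x ∈ S, ‖w x‖ ^ 2) := Real.sqrt_le_sqrt hle
    _ = H * Real.sqrt (∑ x ∈ S, ‖w x‖ ^ 2) := by rw [Real.sqrt_mul (sq_nonneg H), Real.sqrt_sq hH0]
    _ ≤ H * (Real.exp (-(κ * (R - ω))) / Real.sqrt (ν * ν') * Real.sqrt (∑ x ∈ S', ‖v x‖ ^ 2)) :=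
        mul_le_mul_of_nonneg_left hset hH0
    _ = H * (Real.exp (-(κ * (R - ω))) / Real.sqrt (ν * ν')) * Real.sqrt (∑ x ∈ S', ‖v x‖ ^ 2) := by ring

/-- **The PAIRING form (two test families).**  With `u` supported in `S`:
`|u^*A⁻¹v| ≤ e^{−κ(R−ω)}/√(νν′) · √(nsq u) · √(Σ_{x∈S′}‖v_x‖²)` — Cauchy–Schwarz on `S` (b05's `norm_star_dotProduct_le` BY
NAME) and `set_norm_inv_le`; with `u = q_y`, `v = q_{y′}` it is the sandwich entry of `AccretiveCombesThomasSandwichLocal` in the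
SITE-weight currency. [folklore] -/
theorem pairing_inv_le [DecidableEq X] {A : Matrix X X ℂ} {κ : ℝ} {ρ : X → ℝ} {μ : X → ℝ} (hμ : ∀ x, 0 < μ x)
    (hκ : 0 ≤ κ) (hc : ∀ z : X → ℂ, ∑ x, μ x * ‖z x‖ ^ 2 ≤ (conjForm A κ ρ z).re) (S S' : Finset X)
    {v u : X → ℂ} (hv : ∀ x, x ∉ S' → v x = 0) (hu : ∀ x, x ∉ S → u x = 0) {R ω ν ν' : ℝ} (hν : 0 < ν)
    (hν' : 0 < ν') (hR : ∀ x ∈ S, R ≤ ρ x) (hω : ∀ x ∈ S', ρ x ≤ ω) (hνS : ∀ x ∈ S, ν ≤ μ x)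
    (hνS' : ∀ x ∈ S', ν' ≤ μ x) :
    ‖star u ⬝ᵥ (A⁻¹ *ᵥ v)‖ ≤
      Real.exp (-(κ * (R - ω))) / Real.sqrt (ν * ν') * Real.sqrt (nsq u) * Real.sqrt (∑ x ∈ S', ‖v x‖ ^ 2) := by
  set w : X → ℂ := A⁻¹ *ᵥ v with hwdef
  -- cut `w` to `S`: `u^*w = u^*(1_S w)`
  set wS : X → ℂ := fun x => if x ∈ S then w x else 0 with hwS
  have hpair : star u ⬝ᵥ w = star u ⬝ᵥ wS := by
    simp only [dotProduct, Pi.star_apply, hwS]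
    refine Finset.sum_congr rfl fun x _ => ?_
    by_cases hx : x ∈ S
    · rw [if_pos hx]
    · rw [if_neg hx, hu x hx]; simp
  have hnsq : nsq wS = ∑ x ∈ S, ‖w x‖ ^ 2 := by
    unfold nsq
    rw [← Finset.sum_filter_add_sum_filter_not univ (fun x => x ∈ S)]
    have h1 : ∑ x ∈ univ.filter (fun x => x ∈ S), ‖wS x‖ ^ 2 = ∑ x ∈ S, ‖w x‖ ^ 2 := by
      rw [Finset.filter_mem_eq_inter, Finset.univ_inter]
      exact Finset.sum_congr rfl fun x hx => by rw [hwS]; simp only; rw [if_pos hx]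
    have h2 : ∑ x ∈ univ.filter (fun x => ¬ x ∈ S), ‖wS x‖ ^ 2 = 0 :=
      Finset.sum_eq_zero fun x hx => by
        rw [hwS]; simp only; rw [if_neg (Finset.mem_filter.mp hx).2]; simp
    rw [h1, h2, add_zero]
  have hset := set_norm_inv_le hμ hκ hc S S' hv hν hν' hR hω hνS hνS'
  calc ‖star u ⬝ᵥ w‖ = ‖star u ⬝ᵥ wS‖ := by rw [hpair]
    _ ≤ Real.sqrt (nsq u) * Real.sqrt (nsq wS) := norm_star_dotProduct_le u wS
    _ = Real.sqrt (nsq u) * Real.sqrt (∑ x ∈ S, ‖w x‖ ^ 2) := by rw [hnsq]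
    _ ≤ Real.sqrt (nsq u) *
          (Real.exp (-(κ * (R - ω))) / Real.sqrt (ν * ν') * Real.sqrt (∑ x ∈ S', ‖v x‖ ^ 2)) :=
        mul_le_mul_of_nonneg_left hset (Real.sqrt_nonneg _)
    _ = _ := by ring

/-! ## §3 One prefactor: the scale transfer («we may replace the factor (L^jη)^α by (L^jη)^β(L^{j′}η)^γ») -/

/-- **Prefactor transfer** (pure algebra): if `e^{−ακT}·√(ν/ν′) ≤ C` then
`e^{−κT}/√(νν′) ≤ C·e^{−(1−α)κT}/ν` (`ν, ν′ > 0`). [cite: Balaban1985BackgroundPropagators, p.398 remark after (3.47)] [folklore] -/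
theorem prefactor_transfer {κ α T ν ν' C : ℝ} (hν : 0 < ν) (hν' : 0 < ν')
    (hst : Real.exp (-(α * (κ * T))) * Real.sqrt (ν / ν') ≤ C) :
    Real.exp (-(κ * T)) / Real.sqrt (ν * ν') ≤ C * Real.exp (-((1 - α) * (κ * T))) / ν := by
  obtain ⟨a, ha, rfl⟩ : ∃ a, 0 < a ∧ a ^ 2 = ν := ⟨Real.sqrt ν, Real.sqrt_pos.mpr hν, Real.sq_sqrt hν.le⟩
  obtain ⟨b, hb, rfl⟩ : ∃ b, 0 < b ∧ b ^ 2 = ν' := ⟨Real.sqrt ν', Real.sqrt_pos.mpr hν', Real.sq_sqrt hν'.le⟩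
  have ha' : a ≠ 0 := ha.ne'
  have hb' : b ≠ 0 := hb.ne'
  have hratio : Real.sqrt (a ^ 2 / b ^ 2) = a / b := by
    rw [show a ^ 2 / b ^ 2 = (a / b) ^ 2 by rw [div_pow], Real.sqrt_sq (div_nonneg ha.le hb.le)]
  have hprod : Real.sqrt (a ^ 2 * b ^ 2) = a * b := by
    rw [show a ^ 2 * b ^ 2 = (a * b) ^ 2 by ring, Real.sqrt_sq (mul_nonneg ha.le hb.le)]
  rw [hratio] at hst
  rw [hprod]
  have hexp : Real.exp (-(κ * T)) = Real.exp (-(α * (κ * T))) * Real.exp (-((1 - α) * (κ * T))) := by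
    rw [← Real.exp_add]; congr 1; ring
  calc Real.exp (-(κ * T)) / (a * b)
      = (Real.exp (-(α * (κ * T))) * (a / b)) * (Real.exp (-((1 - α) * (κ * T))) / a ^ 2) := by
        rw [hexp]; field_simp
    _ ≤ C * (Real.exp (-((1 - α) * (κ * T))) / a ^ 2) :=
        mul_le_mul_of_nonneg_right hst (div_nonneg (Real.exp_pos _).le (sq_nonneg a))
    _ = C * Real.exp (-((1 - α) * (κ * T))) / a ^ 2 := by ring

/-- **The scale-transfer hypothesis from (2.60)-shaped level data**: `e^{−ακT} ≤ q^{m−1}` (separation of the two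
localizations by `m − 1` thick layers), `√(ν/ν′) ≤ Λ^m` (one factor `Λ ≥ 1` per level step), `Λq ≤ 1` (the located size
condition `RM ≥ ln Λ/(ακ)`) give `e^{−ακT}·√(ν/ν′) ≤ Λ` — b09's `B9Ineq347.pow_pred_mul_pow_le` BY NAME.
[cite: Balaban1984PropagatorsII, Lemma 2.1 (2.60) p.234] [folklore] -/
theorem scaleTransfer_of_levels {κ α T ν ν' q Λ : ℝ} {m : ℕ} (hq : 0 ≤ q) (hΛ : 1 ≤ Λ) (hΛq : Λ * q ≤ 1)
    (h260 : Real.exp (-(α * (κ * T))) ≤ q ^ (m - 1)) (hratio : Real.sqrt (ν / ν') ≤ Λ ^ m) :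
    Real.exp (-(α * (κ * T))) * Real.sqrt (ν / ν') ≤ Λ :=
  calc Real.exp (-(α * (κ * T))) * Real.sqrt (ν / ν') ≤ q ^ (m - 1) * Λ ^ m :=
        mul_le_mul h260 hratio (Real.sqrt_nonneg _) (pow_nonneg hq _)
    _ ≤ Λ := pow_pred_mul_pow_le q Λ hq hΛ hΛq m

/-- For the scale profile `ν = μ₀/s²`, `ν′ = μ₀/s′²` (`μ₀, s, s′ > 0`) the ratio is `√(ν/ν′) = s′/s` — one factor `L` per
level step when `s = L^j`, `s′ = L^{j′}`. [folklore] -/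
theorem sqrt_ratio_of_sq_profile {μ₀ s s' : ℝ} (hμ₀ : 0 < μ₀) (hs : 0 < s) (hs' : 0 < s') :
    Real.sqrt ((μ₀ / s ^ 2) / (μ₀ / s' ^ 2)) = s' / s := by
  rw [show (μ₀ / s ^ 2) / (μ₀ / s' ^ 2) = (s' / s) ^ 2 by field_simp]
  exact Real.sqrt_sq (div_nonneg hs'.le hs.le)

/-- **The ℓ²-localized bound with ONE prefactor at the TARGET** = §1 ∘ `prefactor_transfer`: under the scale-transfer
hypothesis `e^{−ακ(R−ω)}·√(ν/ν′) ≤ C`, `√(Σ_{x∈S}‖(A⁻¹v)_x‖²) ≤ C·e^{−(1−α)κ(R−ω)}/ν · √(Σ_{x∈S′}‖v_x‖²)` — print's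
«B₀(L^jη)²e^{−δ₀d(y,y′)}» shape at the target scale, with the rate lowered from `κ` to `(1−α)κ`.
[cite: Balaban1985BackgroundPropagators, Thm 3.1 (3.46) p.398 and the remark after (3.47)] [folklore] -/
theorem set_norm_inv_le_onePrefactor [DecidableEq X] {A : Matrix X X ℂ} {κ : ℝ} {ρ : X → ℝ} {μ : X → ℝ}
    (hμ : ∀ x, 0 < μ x) (hκ : 0 ≤ κ) (hc : ∀ z : X → ℂ, ∑ x, μ x * ‖z x‖ ^ 2 ≤ (conjForm A κ ρ z).re)
    (S S' : Finset X) {v : X → ℂ} (hv : ∀ x, x ∉ S' → v x = 0) {R ω ν ν' α C : ℝ} (hν : 0 < ν) (hν' : 0 < ν')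
    (hR : ∀ x ∈ S, R ≤ ρ x) (hω : ∀ x ∈ S', ρ x ≤ ω) (hνS : ∀ x ∈ S, ν ≤ μ x) (hνS' : ∀ x ∈ S', ν' ≤ μ x)
    (hst : Real.exp (-(α * (κ * (R - ω)))) * Real.sqrt (ν / ν') ≤ C) :
    Real.sqrt (∑ x ∈ S, ‖(A⁻¹ *ᵥ v) x‖ ^ 2) ≤
      C * Real.exp (-((1 - α) * (κ * (R - ω)))) / ν * Real.sqrt (∑ x ∈ S', ‖v x‖ ^ 2) :=
  (set_norm_inv_le hμ hκ hc S S' hv hν hν' hR hω hνS hνS').trans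
    (mul_le_mul_of_nonneg_right (prefactor_transfer hν hν' hst) (Real.sqrt_nonneg _))

/-! ## §4 Witness: the hypothesis list of §1 is jointly satisfiable and the bound fires -/

/-- One site, `A = (2)`, profile `μ ≡ 2`, weight `ρ ≡ 0`, `S = S′ = univ`, `R = ω = 0`, `ν = ν′ = 2`, `v ≡ 1`:
`set_norm_inv_le` gives `√(Σ‖A⁻¹v‖²) ≤ e^{0}/√(2·2)·√(Σ‖v‖²)` (i.e. `½ ≤ ½`). [folklore] -/
example (κ : ℝ) (hκ : 0 ≤ κ) :
    Real.sqrt (∑ x ∈ (univ : Finset Unit), ‖((((2 : ℝ) : ℂ) • (1 : Matrix Unit Unit ℂ))⁻¹ *ᵥ fun _ => (1 : ℂ)) x‖ ^ 2) ≤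
      Real.exp (-(κ * (0 - 0))) / Real.sqrt (2 * 2) * Real.sqrt (∑ x ∈ (univ : Finset Unit), ‖(fun _ : Unit => (1 : ℂ)) x‖ ^ 2) := by
  refine set_norm_inv_le (μ := fun _ => 2) (ρ := fun _ => 0) (fun _ => by norm_num) hκ (fun z => ?_) univ univ
    (fun _ h => absurd (mem_univ _) h) (by norm_num) (by norm_num) (fun _ _ => le_rfl) (fun _ _ => le_rfl)
    (fun _ _ => le_rfl) (fun _ _ => le_rfl)
  -- the local hypothesis: `Σ 2‖z‖² ≤ Re conjForm (2·1) κ 0 z = 2‖z‖²`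
  simp only [conjForm, Fintype.univ_ofSubsingleton, Finset.sum_singleton, sub_self, mul_zero, Real.exp_zero,
    Complex.ofReal_one, mul_one, Matrix.smul_apply, Matrix.one_apply_eq, smul_eq_mul]
  rw [show (starRingEnd ℂ) (z ()) * ((2 : ℝ) : ℂ) * z () = ((2 : ℝ) : ℂ) * ((starRingEnd ℂ) (z ()) * z ())
    by ring, Complex.conj_mul' (z ())]
  have h2 : ((2 : ℝ) : ℂ) * ((‖z ()‖ : ℂ) ^ 2) = ((2 * ‖z ()‖ ^ 2 : ℝ) : ℂ) := by push_cast; ring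
  rw [h2, Complex.ofReal_re]

end

end Summit.QuantumFields.BalabanUV.Beta.MultiscaleCombesThomasL2
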